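import Literature.Analysis.FluidPDE.LeiZhang2017AxisymmetricCriteria
import Literature.Analysis.FluidPDE.AxisymmetricNoSwirlGlobal
import Literature.Analysis.FluidPDE.CheskidovShvydkoyRegularProofs
import HarnessLib

/-!
# Lei–Zhang 2017, Cor. 1.3: the continuation assembly (from an a-priori `H¹` bound to the fact)

Analysis/FluidPDE proof file (no definitions, no named facts, no `sorry`) on the discharge path of
the named fact `Literature.Analysis.FluidPDE.LeiZhang2017_logModulus_regularity`
(`LeiZhang2017AxisymmetricCriteria.lean`; Z. Lei, Q. S. Zhang, *Criticality of the axially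
symmetric Navier–Stokes equations*, Pacific J. Math. 289 (2017) 169–187 = arXiv:1505.02628,
Cor. 1.3).

The printed proof of Cor. 1.3 / Thm. 1.2 (§3, pp. 8–9) is an **a-priori estimate** for the
local strong solution: "for initial data `v₀ ∈ H^{1/2}`, by the classical results of Leray and
Fujita–Kato, there exists a unique local strong solution … `v(t, ·) ∈ H^s` for any `s ≥ 0` …
So all calculations are legal below as long as the solution is still smooth. Our task is to
derive certain strong enough a priori estimate" (p. 8), closed by "So Serrin type criterion
implies that `v` is regular up to time `T`" (p. 9).  This file proves, once and for all, the
**continuation half** of that sentence in the rendering of the tree, leaving exactly the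
analytic a-priori estimate of §§2–3 to be supplied:

* `hasSmoothExtensionPast_of_apriori_swirlModulus` — let `(u, p)` be a classical solution of
  the unforced system (`ν > 0`) on `ℝ³ × [0, T)`, Leray–Hopf from its rapidly decaying,
  axisymmetric datum `u 0`, whose swirl `Γ = swirl (u t)` obeys a pointwise axis modulus
  `|Γ(t, x)| ≤ m(r)` for `r = cylRadius x ∈ D`, `t ∈ [0, T)`.  **If** every Tao-class solution
  `(v, q)` on a closed slab `[0, T'] ⊆ [0, T]` from the same datum which is axisymmetric and obeys
  the same modulus on `[0, T')` satisfies `∫ ‖Dv(t)‖² ≤ K` for `t ∈ [0, T')`, with one `K` for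
  all `T' ≤ T` (the a-priori bound), **then** `u` extends as a classical solution past `T`.
* `LeiZhang2017_logModulus_regularity_of_apriori` — the specialisation to `ν = 1`,
  `D = (−∞, δ₀]`, `m(r) = C₁ / (log r)²`: the named fact from the a-priori bound of
  Lei–Zhang's Thm. 1.2 under the hypothesis of Cor. 1.3, in Tao's class.

## The argument (Tao 2013, proof of Cor. 11.1 / the tree's `exists_isTaoSolutionOn_of_noSwirl`)

With `c` the constant of Tao's local theorem (`IsTaoSolutionOn.of_tao` fed with the discharged
`tao2011_smooth_local_existence_holds`), `e₀ = 2E(u 0)`, `G₀ = ∫‖D(u 0)‖²`,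
`A = e₀ + 3G₀ + 3 max(K, 0)` and `τ = c ν³/(A² + 1)`:
(i) a Tao-class solution on `[0, F]` from `u 0` coincides with `u` on `[0, min F T)`
(`eq_restart_of_serrin` with the proved `serrin_weak_strong_uniqueness_holds`: it is a bounded
Leray–Hopf solution from the `L²` datum `u 0`), so `F ≤ T` unless `u` extends past `T`, it is
axisymmetric (`IsTaoSolutionOn.isAxisymmetric`) and inherits the modulus on `[0, F)`;
(ii) hence the a-priori bound holds on `[0, F)`, every restart datum `v(a)`, `a < F`, has
`∫|v(a)|² + ∫|∇v(a)|²_F ≤ e₀ + 3K ≤ A` (energy inequality, Frobenius vs operator norm), Tao's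
theorem solves from `v(a)` on `[0, τ]`, and gluing at `a = max 0 (F − τ/2)`
(`IsTaoSolutionOn.glue`) gives `[0, F + τ/2]`;
(iii) starting from `[0, τ]` (datum `u 0 ∈ H^∞`, `HasRapidSpatialDecay.lintegral_enorm_iteratedFDeriv_sq_lt_top`)
the slabs `[0, τ + kτ/2]` would all lie in `[0, T]` — absurd.  So `u` extends past `T`.

## Mathlib / tree search

Everything used is in the tree: `IsTaoSolutionOn.of_tao/.glue/.mono/.slice/.isAxisymmetric/
.lintegral_enorm_sq_le` (`TaoClassGlue`, `AxisymmetricNoSwirlGlobal`), `eq_restart_of_serrin`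
(`NSCriticalClosureTao`), `serrin_weak_strong_uniqueness_holds` (`NSSerrinUniqueness`),
`tao2011_smooth_local_existence_holds` (`CheskidovShvydkoyRegularProofs`),
`lintegral_frobeniusNormSq_le_three_mul` (`AxisymmetricNoSwirlGlobal`),
`IsLerayHopfOn.lintegral_enorm_sq_le`, `HasRapidSpatialDecay.lintegral_enorm_iteratedFDeriv_sq_lt_top`
(`TaoLocalisation`).  `lean search 'apriori_swirlModulus|logModulus_regularity_of'`: nothing before
this file.  Mathlib: `uniqueDiffOn_Ico`, `exists_nat_gt`.

## References

* Z. Lei, Q. S. Zhang, Pacific J. Math. 289 (2017) 169–187, arXiv:1505.02628, Cor. 1.3 (p. 4),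
  proof of Thm. 1.2, §3 (pp. 8–9: the local strong solution, "as long as the solution is still
  smooth", "Serrin type criterion implies that `v` is regular up to time `T`"). [`LeiZhang2017`]
* T. Tao, Anal. PDE 6 (2013) 25–107 = arXiv:1108.1165, Thm. 5.4, Cor. 11.1. [`Tao2011`]
* J. C. Robinson, J. L. Rodrigo, W. Sadowski, *The Three-Dimensional Navier–Stokes Equations*,
  CUP 2016, Thm. 8.19 (weak–strong uniqueness). [`RobinsonRodrigoSadowski2016`]
-/

noncomputable section

open MeasureTheory Set Function Filter Topology
open scoped ENNReal NNReal ContDiff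

namespace Literature.Analysis.FluidPDE

/-! ### Continuation from an a-priori `H¹` bound in Tao's class -/

/-- **Continuation past `T` from an a-priori `H¹` bound under an axis modulus of the swirl**
(the continuation half of Lei–Zhang 2017, proof of Thm. 1.2 / Cor. 1.3, §3, pp. 8–9: local strong
solution from the datum, "all calculations are legal below as long as the solution is still
smooth … derive certain strong enough a priori estimate", "Serrin type criterion implies that `v`
is regular up to time `T`"; carried out with Tao 2013, Thm. 5.4 and the marching of Cor. 11.1).
Let `ν > 0`, `T > 0`, `(u, p)` classical on `ℝ³ × [0, T)` and Leray–Hopf on `[0, T)` from its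
rapidly decaying axisymmetric datum `u 0`, with `|swirl (u t) x| ≤ m (cylRadius x)` whenever
`cylRadius x ∈ D`, `t ∈ [0, T)`.  Assume the a-priori bound: for some real `K`, every Tao-class
solution `(v, q)` on `[0, T']`, `0 < T' ≤ T`, from `u 0`, axisymmetric on `[0, T']` and obeying
the same modulus on `[0, T')`, has `∫ ‖Dv(t)‖² ≤ K` for all `t ∈ [0, T')`.  Then `u` extends as a
classical solution past `T`.  See the module docstring for the marching argument.
[cite: LeiZhang2017, proof of Thm. 1.2, §3 pp. 8–9 (with Tao2011, Thm. 5.4 / Cor. 11.1)] -/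
theorem hasSmoothExtensionPast_of_apriori_swirlModulus {ν T : ℝ}
    {u : ℝ → EuclideanSpace ℝ (Fin 3) → EuclideanSpace ℝ (Fin 3)}
    {p : ℝ → EuclideanSpace ℝ (Fin 3) → ℝ} {D : Set ℝ} {m : ℝ → ℝ}
    (hν : 0 < ν) (hT : 0 < T) (hsol : IsClassicalNSSolutionOn (Ico 0 T) ν 0 u p)
    (hLH : IsLerayHopfOn T ν 0 (u 0) u) (h₀ : HasRapidSpatialDecay (u 0))
    (haxi : IsAxisymmetric (u 0))
    (hmod : ∀ t ∈ Ico 0 T, ∀ x, cylRadius x ∈ D → |swirl (u t) x| ≤ m (cylRadius x))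
    (hK : ∃ K : ℝ, ∀ ⦃T' : ℝ⦄, 0 < T' → T' ≤ T →
      ∀ ⦃v : ℝ → EuclideanSpace ℝ (Fin 3) → EuclideanSpace ℝ (Fin 3)⦄
        ⦃q : ℝ → EuclideanSpace ℝ (Fin 3) → ℝ⦄, IsTaoSolutionOn T' ν (u 0) v q →
        (∀ t ∈ Icc 0 T', IsAxisymmetric (v t)) →
        (∀ t ∈ Ico 0 T', ∀ x, cylRadius x ∈ D → |swirl (v t) x| ≤ m (cylRadius x)) →
        ∀ t ∈ Ico 0 T', ∫⁻ x, ‖iteratedFDeriv ℝ 1 (v t) x‖ₑ ^ 2 ≤ ENNReal.ofReal K) :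
    HasSmoothExtensionPast ν 0 u T := by
  by_contra hnot
  obtain ⟨c, hc, hloc⟩ := IsTaoSolutionOn.of_tao tao2011_smooth_local_existence_holds
  obtain ⟨K, hK⟩ := hK
  have h0I : (0 : ℝ) ∈ Ico 0 T := ⟨le_rfl, hT⟩
  have hsm0 : ContDiff ℝ ∞ (u 0) := hsol.contDiff_velocity h0I
  have hdiv0 : VectorCalculus.IsDivFree (u 0) := hsol.divFree 0 h0I
  have hH : ∀ n : ℕ, ∫⁻ x, ‖iteratedFDeriv ℝ n (u 0) x‖ₑ ^ 2 < ⊤ :=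
    h₀.lintegral_enorm_iteratedFDeriv_sq_lt_top
  /- (i) identification of Tao-class solutions from `u 0` with `u` on `[0, min F T)` -/
  have hLH0 : IsLerayHopfOn (T - 0) ν 0 (u 0) (fun t => u (t + 0)) := by simpa using hLH
  have ident : ∀ ⦃F : ℝ⦄, 0 < F →
      ∀ ⦃v : ℝ → EuclideanSpace ℝ (Fin 3) → EuclideanSpace ℝ (Fin 3)⦄
        ⦃q : ℝ → EuclideanSpace ℝ (Fin 3) → ℝ⦄, IsTaoSolutionOn F ν (u 0) v q →
        ∀ t ∈ Ico 0 (min F T), u t = v t := by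
    intro F hF v q hv t ht
    have h := eq_restart_of_serrin serrin_weak_strong_uniqueness_holds hν hF le_rfl hT hsol hLH0
      hv.classical hv.initial hv.sobolev hv.sobolev_p hv.continuousL2 t
      ⟨ht.1, by simpa using ht.2⟩
    simpa using h
  -- a Tao-class solution from `u 0` cannot live past `T`
  have le_T : ∀ ⦃F : ℝ⦄, 0 < F →
      ∀ ⦃v : ℝ → EuclideanSpace ℝ (Fin 3) → EuclideanSpace ℝ (Fin 3)⦄
        ⦃q : ℝ → EuclideanSpace ℝ (Fin 3) → ℝ⦄, IsTaoSolutionOn F ν (u 0) v q → F ≤ T := by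
    intro F hF v q hv
    by_contra hFT
    push Not at hFT
    exact hnot ⟨F, hFT, v, q, hv.classical.mono Ico_subset_Icc_self (uniqueDiffOn_Ico 0 F),
      fun t ht => (ident hF hv t ⟨ht.1, lt_min (ht.2.trans hFT) ht.2⟩).symm⟩
  /- the constants -/
  set e₀ : ℝ := 2 * VectorCalculus.kineticEnergy (u 0) with he₀
  have he₀0 : 0 ≤ e₀ := mul_nonneg zero_le_two (kineticEnergy_nonneg _)
  have hener0 : ∫⁻ x, ‖u 0 x‖ₑ ^ 2 ≤ ENNReal.ofReal e₀ :=
    hLH.lintegral_enorm_sq_le hν.le ⟨le_rfl, hT.le⟩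
  set G₀ : ℝ := (∫⁻ x, ‖iteratedFDeriv ℝ 1 (u 0) x‖ₑ ^ 2).toReal with hG₀
  have hG₀0 : 0 ≤ G₀ := ENNReal.toReal_nonneg
  have hG₀le : ∫⁻ x, ‖iteratedFDeriv ℝ 1 (u 0) x‖ₑ ^ 2 ≤ ENNReal.ofReal G₀ := by
    rw [hG₀, ENNReal.ofReal_toReal (hH 1).ne]
  set K' : ℝ := max K 0 with hK'
  have hK'0 : 0 ≤ K' := le_max_right _ _
  have hKK' : ENNReal.ofReal K ≤ ENNReal.ofReal K' := ENNReal.ofReal_le_ofReal (le_max_left _ _)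
  set A : ℝ := e₀ + 3 * G₀ + 3 * K' with hAdef
  have hA0 : 0 ≤ A := by positivity
  set τ : ℝ := c * ν ^ 3 / (A ^ 2 + 1) with hτ
  have hτpos : 0 < τ := by positivity
  have hτc : A ^ 2 * τ ≤ c * ν ^ 3 := by
    calc A ^ 2 * τ = c * ν ^ 3 * (A ^ 2 / (A ^ 2 + 1)) := by rw [hτ]; ring
      _ ≤ c * ν ^ 3 * 1 :=
          mul_le_mul_of_nonneg_left (by rw [div_le_one (by positivity)]; linarith) (by positivity)
      _ = c * ν ^ 3 := mul_one _
  have h3 : ∀ x : ℝ, ENNReal.ofReal (3 * x) = 3 * ENNReal.ofReal x := fun x => by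
    rw [ENNReal.ofReal_mul (by norm_num), ENNReal.ofReal_ofNat]
  -- Tao's local solver on `[0, τ]` for data of `H¹`-size at most `A`
  have solve : ∀ a : EuclideanSpace ℝ (Fin 3) → EuclideanSpace ℝ (Fin 3), ContDiff ℝ ∞ a →
      VectorCalculus.IsDivFree a → (∀ n : ℕ, ∫⁻ x, ‖iteratedFDeriv ℝ n a x‖ₑ ^ 2 < ⊤) →
      (∫⁻ x, ‖a x‖ₑ ^ 2) + (∫⁻ x, ENNReal.ofReal (frobeniusNormSq (fderiv ℝ a x))) ≤
        ENNReal.ofReal A →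
      ∃ (v : ℝ → EuclideanSpace ℝ (Fin 3) → EuclideanSpace ℝ (Fin 3))
        (q : ℝ → EuclideanSpace ℝ (Fin 3) → ℝ), IsTaoSolutionOn τ ν a v q :=
    fun a h1 h2 h3 h4 => hloc hν hτpos h1 h2 h3 hA0 h4 hτc
  /- (iii) base: the solution from `u 0` on `[0, τ]` -/
  have base : ∃ (v : ℝ → EuclideanSpace ℝ (Fin 3) → EuclideanSpace ℝ (Fin 3))
      (q : ℝ → EuclideanSpace ℝ (Fin 3) → ℝ), IsTaoSolutionOn τ ν (u 0) v q := by
    refine solve (u 0) hsm0 hdiv0 hH ?_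
    calc (∫⁻ x, ‖u 0 x‖ₑ ^ 2) + ∫⁻ x, ENNReal.ofReal (frobeniusNormSq (fderiv ℝ (u 0) x))
        ≤ ENNReal.ofReal e₀ + 3 * ENNReal.ofReal G₀ :=
          add_le_add hener0 ((lintegral_frobeniusNormSq_le_three_mul (u 0)).trans (by gcongr))
      _ = ENNReal.ofReal (e₀ + 3 * G₀) := by
          rw [ENNReal.ofReal_add he₀0 (by positivity), h3]
      _ ≤ ENNReal.ofReal A := ENNReal.ofReal_le_ofReal (by rw [hAdef]; linarith)
  /- (ii) step: from `[0, F]` to `[0, F + τ/2]` -/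
  have step : ∀ F : ℝ, 0 < F →
      (∃ (v : ℝ → EuclideanSpace ℝ (Fin 3) → EuclideanSpace ℝ (Fin 3))
        (q : ℝ → EuclideanSpace ℝ (Fin 3) → ℝ), IsTaoSolutionOn F ν (u 0) v q) →
      ∃ (v : ℝ → EuclideanSpace ℝ (Fin 3) → EuclideanSpace ℝ (Fin 3))
        (q : ℝ → EuclideanSpace ℝ (Fin 3) → ℝ), IsTaoSolutionOn (F + τ / 2) ν (u 0) v q := by
    rintro F hF ⟨v, q, hv⟩
    have hFT : F ≤ T := le_T hF hv
    -- symmetry, the modulus and the a-priori bound on `[0, F)`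
    have haxiF : ∀ t ∈ Icc 0 F, IsAxisymmetric (v t) := hv.isAxisymmetric hν hF haxi
    have hmodF : ∀ t ∈ Ico 0 F, ∀ x, cylRadius x ∈ D → |swirl (v t) x| ≤ m (cylRadius x) := by
      intro t ht x hx
      rw [← ident hF hv t ⟨ht.1, lt_min ht.2 (ht.2.trans_le hFT)⟩]
      exact hmod t ⟨ht.1, ht.2.trans_le hFT⟩ x hx
    have hKF : ∀ t ∈ Ico 0 F, ∫⁻ x, ‖iteratedFDeriv ℝ 1 (v t) x‖ₑ ^ 2 ≤ ENNReal.ofReal K' :=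
      fun t ht => (hK hF hFT hv haxiF hmodF t ht).trans hKK'
    -- restart at `a = max 0 (F - τ/2)`
    set a : ℝ := max 0 (F - τ / 2) with ha
    have ha0 : 0 ≤ a := le_max_left _ _
    have haF : a < F := max_lt hF (by linarith)
    have haI : a ∈ Icc 0 F := ⟨ha0, haF.le⟩
    obtain ⟨hsm_a, hdiv_a, hH_a⟩ := hv.slice haI
    have hbound : (∫⁻ x, ‖v a x‖ₑ ^ 2) +
        (∫⁻ x, ENNReal.ofReal (frobeniusNormSq (fderiv ℝ (v a) x))) ≤ ENNReal.ofReal A := by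
      calc (∫⁻ x, ‖v a x‖ₑ ^ 2) + ∫⁻ x, ENNReal.ofReal (frobeniusNormSq (fderiv ℝ (v a) x))
          ≤ ENNReal.ofReal e₀ + 3 * ENNReal.ofReal K' :=
            add_le_add (hv.lintegral_enorm_sq_le hF hν.le haI)
              ((lintegral_frobeniusNormSq_le_three_mul (v a)).trans
                (by gcongr; exact hKF a ⟨ha0, haF⟩))
        _ = ENNReal.ofReal (e₀ + 3 * K') := by
            rw [ENNReal.ofReal_add he₀0 (by positivity), h3]
        _ ≤ ENNReal.ofReal A := ENNReal.ofReal_le_ofReal (by rw [hAdef]; linarith)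
    obtain ⟨w, r, hw⟩ := solve (v a) hsm_a hdiv_a hH_a hbound
    have hglue := hv.glue hw hν hτpos ha0 haF
      (by rw [ha]; linarith [le_max_right 0 (F - τ / 2)])
    exact ⟨_, _, hglue.mono (by positivity)
      (by rw [ha]; linarith [le_max_right 0 (F - τ / 2)])⟩
  /- (iii) induction: `[0, τ + k τ/2]` for every `k` -/
  have iter : ∀ k : ℕ, ∃ (v : ℝ → EuclideanSpace ℝ (Fin 3) → EuclideanSpace ℝ (Fin 3))
      (q : ℝ → EuclideanSpace ℝ (Fin 3) → ℝ), IsTaoSolutionOn (τ + k * (τ / 2)) ν (u 0) v q := by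
    intro k
    induction k with
    | zero => simpa using base
    | succ k ih =>
      have h := step _ (by positivity) ih
      have e : τ + (k : ℝ) * (τ / 2) + τ / 2 = τ + ((k + 1 : ℕ) : ℝ) * (τ / 2) := by
        push_cast; ring
      rwa [e] at h
  /- conclusion -/
  obtain ⟨k, hk⟩ := exists_nat_gt (T / (τ / 2))
  obtain ⟨v, q, hv⟩ := iter k
  have h1 : τ + k * (τ / 2) ≤ T := le_T (by positivity) hv
  have h2 : T < k * (τ / 2) := by
    have := (div_lt_iff₀ (by positivity : (0 : ℝ) < τ / 2)).1 hk
    linarith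
  linarith

/-! ### The named fact from the a-priori bound -/

/-- **Lei–Zhang 2017, Cor. 1.3, from its a-priori estimate.**  The a-priori content of the
printed proof (Thm. 1.2 under the hypothesis of Cor. 1.3, §§2–3: the form boundedness
condition from the logarithmic modulus, the critical `(J, Ω)` energy estimates (E1)–(E8),
Lemma 2.1, the `L⁴`/`ω^θ` bootstrap) in Tao's smooth class reads: for `ν = 1`, every
`δ₀ ∈ (0, 1/2)`, `C₁ > 1`, `T > 0` and every smooth divergence-free rapidly decaying axisymmetric
datum `u₀` there is `K` such that every Tao-class solution on `[0, T'] ⊆ [0, T]` from `u₀`,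
axisymmetric and with `|Γ(t, x)| ≤ C₁ / (log r)²` for `r = cylRadius x ≤ δ₀`, `t ∈ [0, T')`, has
`∫ ‖Dv(t)‖² ≤ K` on `[0, T')`.  Granted this, the named fact `LeiZhang2017_logModulus_regularity`
follows (`hasSmoothExtensionPast_of_apriori_swirlModulus` with `D = (−∞, δ₀]`,
`m r = C₁ / (log r)²`; the datum `u 0` of the fact is a smooth divergence-free slice of the
classical solution, rapidly decaying and axisymmetric by hypothesis).
[cite: LeiZhang2017, Cor. 1.3 and proof of Thm. 1.2, §3 pp. 8–9] -/
theorem LeiZhang2017_logModulus_regularity_of_apriori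
    (hA : ∀ ⦃δ₀ C₁ T : ℝ⦄, 0 < δ₀ → δ₀ < 1 / 2 → 1 < C₁ → 0 < T →
      ∀ ⦃u₀ : EuclideanSpace ℝ (Fin 3) → EuclideanSpace ℝ (Fin 3)⦄, ContDiff ℝ ∞ u₀ →
        VectorCalculus.IsDivFree u₀ → HasRapidSpatialDecay u₀ → IsAxisymmetric u₀ →
        ∃ K : ℝ, ∀ ⦃T' : ℝ⦄, 0 < T' → T' ≤ T →
          ∀ ⦃v : ℝ → EuclideanSpace ℝ (Fin 3) → EuclideanSpace ℝ (Fin 3)⦄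
            ⦃q : ℝ → EuclideanSpace ℝ (Fin 3) → ℝ⦄, IsTaoSolutionOn T' 1 u₀ v q →
            (∀ t ∈ Icc 0 T', IsAxisymmetric (v t)) →
            (∀ t ∈ Ico 0 T', ∀ x, cylRadius x ≤ δ₀ →
              |swirl (v t) x| ≤ C₁ / Real.log (cylRadius x) ^ 2) →
            ∀ t ∈ Ico 0 T', ∫⁻ x, ‖iteratedFDeriv ℝ 1 (v t) x‖ₑ ^ 2 ≤ ENNReal.ofReal K) :
    LeiZhang2017_logModulus_regularity := by
  intro δ₀ C₁ hδ₀ hδ₀' hC₁ T u p hT hsol hLH hdec haxi _hΓ hmod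
  have h0I : (0 : ℝ) ∈ Ico 0 T := ⟨le_rfl, hT⟩
  obtain ⟨K, hK⟩ := hA hδ₀ hδ₀' hC₁ hT (hsol.contDiff_velocity h0I) (hsol.divFree 0 h0I) hdec
    (haxi 0 h0I)
  exact hasSmoothExtensionPast_of_apriori_swirlModulus (D := Iic δ₀)
    (m := fun r => C₁ / Real.log r ^ 2) one_pos hT hsol hLH hdec (haxi 0 h0I)
    (fun t ht x hx => hmod t ht x hx)
    ⟨K, fun T' hT' hT'T v q hv hax hm => hK hT' hT'T hv hax fun t ht x hx => hm t ht x hx⟩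

end Literature.Analysis.FluidPDE

end
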